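import Mathlib.Algebra.Polynomial.AlgebraMap
import Mathlib.Algebra.Group.Semiconj.Units
import Mathlib.LinearAlgebra.Eigenspace.Basic
import Mathlib.Tactic.LinearCombination
import HarnessLib

/-!
# Conjugation by a (semi)linear automorphism: transport of polynomial operators, kernels,
# eigenspaces and invertibility («Fricke bookkeeping»)

Elementary (semi)linear algebra, sorry-free, THEOREMS ONLY (no definition, no named fact); namespace
`Literature.LinearAlgebra.SemilinearConj` (linear, field-only `conj_pow` / `range_conj` exist in
`Literature.LinearAlgebra.TateResidue.Tate`; the point here is the SEMILINEAR twist, over semirings).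

Setting. `W : M ≃ₛₗ[σ] M₂` is a `σ`-SEMILINEAR isomorphism (`σ : R →+* S` with inverse `σ'`;
the linear case is `σ = id`), `T : Module.End R M`, `W.conj T = W ∘ T ∘ W⁻¹` (Mathlib `LinearEquiv.conj`).

* §1 `conj_aeval` — **conjugating a polynomial operator twists its coefficients**:
  `W ∘ P(T) ∘ W⁻¹ = P^σ(W T W⁻¹)`, i.e. `W.conj (aeval T P) = aeval (W.conj T) (P.map σ)`; the ring
  form `units_conj_eval₂` (`W ∈ Aˣ`, scalars `φ : Λ →+* A` with `W φ(λ) W⁻¹ = φ(ι λ)`); hence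
  `W ∘ P(T) ∘ W⁻¹ = P(W T W⁻¹)` holds when `σ` FIXES the coefficients of `P` (`conj_aeval_of_map_eq`,
  in particular for linear `W`, `conj_aeval_linear`) — and only such an identity is available in
  general.
* §2 `mul_inv_mul_conj_eq_of_commute` — **transport** («Lemma T»): if `X` commutes with `Y` then the
  operator `Op := Y · W⁻¹` satisfies `Op · (W X W⁻¹) = X · Op`; the shape
  `Op = ∑_α c_α · D_α · U^r · W⁻¹` with `X` commuting with every `D_α` and with `U`
  (`sum_smul_mul_pow_mul_inv_transport`); the module form for a map `S : V → N` intertwining `X`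
  with `Y` (`comp_symm_comp_conj_eq`), and the reformulation `W X W⁻¹ = Op⁻¹ ∘ Y ∘ Op` when `Op` is
  invertible (`conj_eq_symm_conj_of_intertwine`).
* §3 transport of kernels, ranges, stable subspaces, eigenspaces (`eigenspace (W.conj T) (σ μ) =
  W (eigenspace T μ)` — the eigenvalue is TWISTED by `σ`), bijectivity on a stable subspace, and
  units (`isUnit_conj_iff`) under `W.conj`.
* §4 `eisensteinWitness_separation` — four elementary inequalities in a field.

## Why this file exists (documentary; nothing below depends on it)

Cell `bsd-litref/cgs25` (row D4), the L-η assembly line of [KLZ17] = Kings–Loeffler–Zerbes,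
*Rankin–Eisenstein classes and explicit reciprocity laws*, Camb. J. Math. 5 (2017), §7.4 / §9.5.
Reader 2's ERRATUM E-r2-1 (D-AUDIT-cgs25-r2-ADDENDUM-11, 2026-08-27) withdrew the sentence
«`W_{Np^r} Θ₀ W_{Np^r}⁻¹ = Θ₀`» for the quasi-projector `Θ₀ = ∏ (T_ℓ − 𝔄(η₁,η₂))^n`, a polynomial
in `T_ℓ` with coefficients in `Λ_D ⊗ 𝒪` acting through the diamond operators: the Atkin–Lehner–
Fricke operator `w = W_{Np^r}` satisfies `w T_ℓ w⁻¹ = T_ℓ* = ⟨ℓ⟩⁻¹ T_ℓ` and `w ⟨d⟩ w⁻¹ = ⟨d⟩* = ⟨d⟩⁻¹`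
(Diamond–Shurman, Thm. 5.5.3 and (5.16) [corpus: book:diamond2005-first-course-modular-forms
p0207:L11–L14, p0208:L7–L10, p0208:L20]), so `w` is `ι`-SEMILINEAR for the `Λ_D`-structure
(`ι[u] = [u⁻¹]`) and §1 gives `w Θ₀(T_ℓ) w⁻¹ = Θ₀^ι(T_ℓ')` — the coefficients are inverted, the
withdrawn identity is not available. The corrected mechanism (ADDENDUM-11 §2, «Lemma T») is the
transport identity of §2 for Ohta's operator of [KLZ17] Lemma 7.4.2,
`spec_{k+ε} 𝓦_k = ∑_{α ∈ (ℤ/p^r)ˣ} ε(α)⁻¹ · (⟨α⟩_p ∘ U_p^r ∘ W_{Np^r}⁻¹)` [corpus: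
paper:arxiv-1503.02888-gx17373040 p0064:L3–L13]: for `X ∈ {T_ℓ, ⟨u⟩_p}` commuting with `⟨α⟩_p`
and `U_p`, `spec 𝓦_k ∘ (W X W⁻¹) = X ∘ spec 𝓦_k`; §3 is the bookkeeping of ADDENDUM-11 (P-i)/(P-iii)
(a conjugate operator kills / preserves / is invertible on the TRANSPORTED subspaces); §4 is the
arithmetic tail of the witness of ADDENDUM-11 §1 (`χ̄(ℓ) + ℓ` and `1 + χ(ℓ)ℓ` avoid
`{1 + χ̄(ℓ)ℓ, χ(ℓ) + ℓ}` as soon as `χ(ℓ) ∉ {0, ±1}`, `ℓ ∉ {0, 1}`). HONEST SCOPE: pure algebra;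
nothing here is a statement about modular forms, Hida families or `Λ`-adic Eichler–Shimura maps,
and the modular inputs of the witness (Eisenstein eigenvalues, `w E₂(𝟙,χ) ∝ E₂(χ̄,𝟙)`) are
reading-grade. Companions (same cell): `EigenvalueSeparatingAnnihilator.lean`,
`EndomorphismVanishingOfDisjointSupport.lean` §5, `EisensteinCuspidalEigenvalueSeparation.lean`.

## References

* [KingsLoefflerZerbes2015] / [KingsLoefflerZerbes2017] G. Kings, D. Loeffler, S. L. Zerbes,
  arXiv:1503.02888 = Camb. J. Math. 5 (2017): Lemma 7.4.2, §9.5 (arXiv numbering, corpus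
  paper:arxiv-1503.02888-gx17373040).
* [DiamondShurman2005] F. Diamond, J. Shurman, GTM 228, Thm. 5.5.3, (5.16), Exercise 5.5.1.
-/

namespace Literature.LinearAlgebra.SemilinearConj

open Polynomial

/-! ### §1 Conjugating a polynomial operator twists its coefficients -/

section RingForm

variable {Λ A : Type*} [CommSemiring Λ] [Semiring A]

/-- **Ring form.** Let `φ : Λ →+* A` be a "scalar" structure on a ring `A` (e.g. a group ring
acting through diamond operators), `W ∈ Aˣ` a unit that TWISTS the scalars through `ι : Λ →+* Λ`
(`W φ(λ) W⁻¹ = φ(ι λ)`), and `T ∈ A`. Then for every polynomial `P ∈ Λ[X]`,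
`W · P(T) · W⁻¹ = P^ι(W T W⁻¹)`, where `P^ι = P.map ι` has the twisted coefficients. (With the
Fricke involution `w`, `w⟨d⟩w⁻¹ = ⟨d⟩⁻¹`, this is `w Θ₀(T_ℓ) w⁻¹ = Θ₀^ι(T_ℓ')`.) [cite: DiamondShurman2005, Thm. 5.5.3 and (5.16) (corpus book:diamond2005-first-course-modular-forms p0207:L11–L14, p0208:L7–L20: w T w⁻¹ = T*, w⟨d⟩w⁻¹ = ⟨d⟩⁻¹ — the algebra of conjugating a polynomial in T_ℓ with diamond coefficients; cgs25-r2 ADDENDUM-11 §1, in-cell)] -/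
theorem units_conj_eval₂ (φ : Λ →+* A) (ι : Λ →+* Λ) (W : Aˣ)
    (hW : ∀ r, (W : A) * φ r * ↑W⁻¹ = φ (ι r)) (T : A) (P : Λ[X]) :
    (W : A) * P.eval₂ φ T * ↑W⁻¹ = (P.map ι).eval₂ φ ((W : A) * T * ↑W⁻¹) := by
  induction P using Polynomial.induction_on' with
  | add p q hp hq =>
    rw [eval₂_add, Polynomial.map_add, eval₂_add, mul_add, add_mul, hp, hq]
  | monomial n r =>
    rw [eval₂_monomial, Polynomial.map_monomial, eval₂_monomial, ← hW, Units.conj_pow]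
    simp only [mul_assoc, Units.inv_mul_cancel_left]

/-- **Ring form, untwisted scalars.** If `W` commutes with the scalars (`W φ(λ) W⁻¹ = φ(λ)`), then
`W · P(T) · W⁻¹ = P(W T W⁻¹)` with the SAME coefficients. [cite: DiamondShurman2005, Thm. 5.5.3 and (5.16) (conjugation bookkeeping; cgs25-r2 ADDENDUM-11 §1, in-cell)] -/
theorem units_conj_eval₂_of_forall_commute (φ : Λ →+* A) (W : Aˣ)
    (hW : ∀ r, (W : A) * φ r * ↑W⁻¹ = φ r) (T : A) (P : Λ[X]) :
    (W : A) * P.eval₂ φ T * ↑W⁻¹ = P.eval₂ φ ((W : A) * T * ↑W⁻¹) := by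
  simpa only [Polynomial.map_id] using
    units_conj_eval₂ φ (RingHom.id Λ) W (fun r ↦ by rw [RingHom.id_apply]; exact hW r) T P

end RingForm

section Semilinear

variable {R S : Type*} [CommSemiring R] [CommSemiring S] {σ : R →+* S} {σ' : S →+* R}
  [RingHomInvPair σ σ'] [RingHomInvPair σ' σ]
  {M M₂ : Type*} [AddCommMonoid M] [Module R M] [AddCommMonoid M₂] [Module S M₂]
  (W : M ≃ₛₗ[σ] M₂)

/-- `W.conj` is multiplicative: `W (f g) W⁻¹ = (W f W⁻¹)(W g W⁻¹)`. [cite: DiamondShurman2005, Thm. 5.5.3 and (5.16) (conjugation bookkeeping; cgs25-r2 ADDENDUM-11 §1, in-cell)] -/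
theorem conj_mul (f g : Module.End R M) : W.conj (f * g) = W.conj f * W.conj g := by
  rw [Module.End.mul_eq_comp, Module.End.mul_eq_comp]
  exact LinearEquiv.conj_comp W g f

/-- `W.conj 1 = 1`. [cite: DiamondShurman2005, Thm. 5.5.3 and (5.16) (conjugation bookkeeping; cgs25-r2 ADDENDUM-11 §1, in-cell)] -/
theorem conj_one : W.conj (1 : Module.End R M) = 1 := by
  rw [Module.End.one_eq_id, Module.End.one_eq_id]
  exact LinearEquiv.conj_id W

/-- `W.conj (f ^ n) = (W.conj f) ^ n`. [cite: DiamondShurman2005, Thm. 5.5.3 and (5.16) (conjugation bookkeeping; cgs25-r2 ADDENDUM-11 §1, in-cell)] -/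
theorem conj_pow (f : Module.End R M) (n : ℕ) : W.conj (f ^ n) = W.conj f ^ n := by
  induction n with
  | zero => rw [pow_zero, pow_zero, conj_one]
  | succ n ih => rw [pow_succ, conj_mul, ih, pow_succ]

/-- A `σ`-semilinear `W` twists the scalar operators: `W ∘ (r • id) ∘ W⁻¹ = σ(r) • id`.
[cite: DiamondShurman2005, Thm. 5.5.3 and (5.16) (conjugation bookkeeping; cgs25-r2 ADDENDUM-11 §1, in-cell)] -/
theorem conj_algebraMap (r : R) :
    W.conj (algebraMap R (Module.End R M) r) = algebraMap S (Module.End S M₂) (σ r) := by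
  rw [Algebra.algebraMap_eq_smul_one, Algebra.algebraMap_eq_smul_one, LinearEquiv.map_smulₛₗ,
    conj_one]

/-- **Conjugating a polynomial operator by a `σ`-semilinear isomorphism twists its coefficients**:
`W ∘ P(T) ∘ W⁻¹ = P^σ(W ∘ T ∘ W⁻¹)`, i.e. `W.conj (aeval T P) = aeval (W.conj T) (P.map σ)`.
For the Fricke involution `w` on modular forms of level `Np^r`, which is `ι`-semilinear for the
diamond-operator (`Λ_D`-) structure (`w⟨d⟩w⁻¹ = ⟨d⟩⁻¹`, Diamond–Shurman (5.16) / Exercise 5.5.1(a)),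
this reads `w Θ₀(T_ℓ) w⁻¹ = Θ₀^ι(T_ℓ')`: the coefficients `𝔄 ∈ Λ_D ⊗ 𝒪` of the quasi-projector are
replaced by `ι(𝔄)` (cgs25-r2 ADDENDUM-11 §1). [cite: DiamondShurman2005, Thm. 5.5.3 and (5.16) (corpus book:diamond2005-first-course-modular-forms p0207:L11–L14, p0208:L7–L20: w T w⁻¹ = T*, w⟨d⟩w⁻¹ = ⟨d⟩⁻¹ — the algebra of conjugating a polynomial in T_ℓ with diamond coefficients; cgs25-r2 ADDENDUM-11 §1, in-cell)] -/
theorem conj_aeval (T : Module.End R M) (P : R[X]) :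
    W.conj (aeval T P) = aeval (W.conj T) (P.map σ) := by
  induction P using Polynomial.induction_on' with
  | add p q hp hq => simp only [map_add, Polynomial.map_add, hp, hq]
  | monomial n r =>
    rw [aeval_monomial, Polynomial.map_monomial, aeval_monomial, conj_mul, conj_pow,
      conj_algebraMap]

end Semilinear

section SemilinearEigen

variable {R S : Type*} [CommRing R] [CommRing S] {σ : R →+* S} {σ' : S →+* R}
  [RingHomInvPair σ σ'] [RingHomInvPair σ' σ]
  {M M₂ : Type*} [AddCommGroup M] [Module R M] [AddCommGroup M₂] [Module S M₂]
  (W : M ≃ₛₗ[σ] M₂)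

/-- **Transport of eigenvectors, twisted eigenvalue**: `x` is in the `σ(μ)`-eigenspace of
`W T W⁻¹` iff `W⁻¹ x` is in the `μ`-eigenspace of `T`. [cite: KingsLoefflerZerbes2015, §9.5, proof of Thm 9.5.2 («Since both maps are Hecke-equivariant …»; transport bookkeeping = cgs25-r2 ADDENDUM-11 (P-i)/(P-iii), in-cell)] -/
theorem mem_eigenspace_conj_iff (T : Module.End R M) (μ : R)
    (x : M₂) :
    x ∈ Module.End.eigenspace (W.conj T) (σ μ) ↔ W.symm x ∈ Module.End.eigenspace T μ := by
  rw [Module.End.mem_eigenspace_iff, Module.End.mem_eigenspace_iff, LinearEquiv.conj_apply_apply]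
  constructor
  · intro h
    have h' := congrArg W.symm h
    rwa [LinearEquiv.symm_apply_apply, LinearEquiv.map_smulₛₗ, RingHomInvPair.comp_apply_eq]
      at h'
  · intro h
    rw [h, LinearEquiv.map_smulₛₗ, LinearEquiv.apply_symm_apply]

/-- **`W` carries the `μ`-eigenspace of `T` onto the `σ(μ)`-eigenspace of `W T W⁻¹`**:
`eigenspace (W.conj T) (σ μ) = W (eigenspace T μ)` — under a twisting `W` a `T`-eigenvalue `𝔄`
becomes the `W T W⁻¹`-eigenvalue `ι(𝔄)` (cgs25-r2 ADDENDUM-11 §1: `η₁(ℓ) + η₂(ℓ)ℓ[ℓ]` goes to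
`η₁(ℓ) + η₂(ℓ)ℓ[ℓ]⁻¹`). [cite: KingsLoefflerZerbes2015, §9.5, proof of Thm 9.5.2 («Since both maps are Hecke-equivariant …»; transport bookkeeping = cgs25-r2 ADDENDUM-11 (P-i)/(P-iii), in-cell)] -/
theorem eigenspace_conj_eq_map (T : Module.End R M) (μ : R) :
    Module.End.eigenspace (W.conj T) (σ μ) =
      (Module.End.eigenspace T μ).map (W : M →ₛₗ[σ] M₂) := by
  ext x
  rw [mem_eigenspace_conj_iff, Submodule.mem_map_equiv]

/-- **Eigenvalues are transported with the twist**: `σ(μ)` is an eigenvalue of `W T W⁻¹` iff `μ`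
is an eigenvalue of `T`. [cite: KingsLoefflerZerbes2015, §9.5, proof of Thm 9.5.2 («Since both maps are Hecke-equivariant …»; transport bookkeeping = cgs25-r2 ADDENDUM-11 (P-i)/(P-iii), in-cell)] -/
theorem hasEigenvalue_conj_iff (T : Module.End R M) (μ : R) :
    Module.End.HasEigenvalue (W.conj T) (σ μ) ↔ Module.End.HasEigenvalue T μ := by
  rw [Module.End.hasEigenvalue_iff, Module.End.hasEigenvalue_iff, eigenspace_conj_eq_map]
  exact not_congr Submodule.map_eq_bot_iff

end SemilinearEigen

section SameRing

variable {R : Type*} [CommSemiring R] {σ σ' : R →+* R} [RingHomInvPair σ σ'] [RingHomInvPair σ' σ]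
  {M M₂ : Type*} [AddCommMonoid M] [Module R M] [AddCommMonoid M₂] [Module R M₂]

/-- **When is `W P(T) W⁻¹ = P(W T W⁻¹)` with the SAME coefficients?** Whenever `σ` fixes the
coefficients of `P` (`P.map σ = P`) — e.g. constant (`𝒪`-) coefficients under the diamond
inversion `ι`; for general `Λ_D`-coefficients only the twisted identity `conj_aeval` holds
(cgs25-r2 ADDENDUM-11 §1, repair census (b)). [cite: DiamondShurman2005, Thm. 5.5.3 and (5.16) (conjugation bookkeeping; cgs25-r2 ADDENDUM-11 §1, in-cell)] -/
theorem conj_aeval_of_map_eq (W : M ≃ₛₗ[σ] M₂) (T : Module.End R M) {P : R[X]}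
    (hP : P.map σ = P) : W.conj (aeval T P) = aeval (W.conj T) P := by
  rw [conj_aeval, hP]

/-- **Linear case**: for an `R`-LINEAR isomorphism `W`, `W ∘ P(T) ∘ W⁻¹ = P(W ∘ T ∘ W⁻¹)`.
[cite: DiamondShurman2005, Thm. 5.5.3 and (5.16) (conjugation bookkeeping; cgs25-r2 ADDENDUM-11 §1, in-cell)] -/
theorem conj_aeval_linear (W : M ≃ₗ[R] M₂) (T : Module.End R M) (P : R[X]) :
    W.conj (aeval T P) = aeval (W.conj T) P :=
  conj_aeval_of_map_eq W T (Polynomial.map_id (R := R) (p := P))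

end SameRing

/-! ### §2 Transport through an operator of the shape `Y · W⁻¹` («Lemma T») -/

section Transport

variable {A : Type*} [Monoid A]

/-- **Transport identity** («Lemma T», ring form). If `X` commutes with `Y`, then
`Op := Y · W⁻¹` intertwines the conjugate `W X W⁻¹` with `X`: `Op · (W X W⁻¹) = X · Op`. No
identity `W X W⁻¹ = X` is needed or claimed. [cite: KingsLoefflerZerbes2015, Lemma 7.4.2 (arXiv numbering; corpus paper:arxiv-1503.02888-gx17373040 p0064:L3–L13: the formula spec_{k+ε} 𝓦_k = Σ_α ε(α)⁻¹ ⟨α⟩_p U_p^r W_{Np^r}⁻¹; equivariance step = cgs25-r2 ADDENDUM-11 §2 «Lemma T», in-cell)] -/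
theorem mul_inv_mul_conj_eq_of_commute (W : Aˣ) {X Y : A} (h : Commute X Y) :
    Y * ↑W⁻¹ * ((W : A) * X * ↑W⁻¹) = X * (Y * ↑W⁻¹) := by
  calc Y * ↑W⁻¹ * ((W : A) * X * ↑W⁻¹) = Y * (↑W⁻¹ * ((W : A) * X)) * ↑W⁻¹ := by
        simp only [mul_assoc]
    _ = Y * X * ↑W⁻¹ := by rw [Units.inv_mul_cancel_left]
    _ = X * (Y * ↑W⁻¹) := by rw [← h.eq, mul_assoc]

/-- **Transport identity with a named conjugate**: if `X` commutes with `Y` and `W X W⁻¹ = X'`, then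
`(Y W⁻¹) · X' = X · (Y W⁻¹)` (e.g. `X = ⟨u⟩`, `X' = ⟨u⟩⁻¹` for the Fricke involution:
`Op ∘ ⟨u⟩⁻¹ = ⟨u⟩ ∘ Op`). [cite: KingsLoefflerZerbes2015, Lemma 7.4.2 (equivariance step; cgs25-r2 ADDENDUM-11 §2 «Lemma T», in-cell)] -/
theorem mul_inv_mul_eq_of_commute_of_conj_eq (W : Aˣ) {X X' Y : A} (h : Commute X Y)
    (hX' : (W : A) * X * ↑W⁻¹ = X') : Y * ↑W⁻¹ * X' = X * (Y * ↑W⁻¹) := by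
  rw [← hX']
  exact mul_inv_mul_conj_eq_of_commute W h

end Transport

section TransportSum

variable {K A : Type*} [CommSemiring K] [Semiring A] [Algebra K A]

/-- **Lemma T in the shape of [KLZ17] Lemma 7.4.2.** Let
`Op := (∑_{α ∈ s} c_α · D_α · U^r) · W⁻¹` (Ohta's `spec_{k+ε} 𝓦_k = ∑_α ε(α)⁻¹ ⟨α⟩_p U_p^r W_{Np^r}⁻¹`,
[KLZ17] p. 64), with central scalars `c_α`, and let `X` commute with every `D_α` (`α ∈ s`) and with
`U` (e.g. `X = T_ℓ` or `⟨u⟩_p`, `ℓ ∤ Np`). Then `Op · (W X W⁻¹) = X · Op`: on the tower side the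
operator corresponding to `X` is the CONJUGATE `W X W⁻¹` (so `𝓦_k⁻¹ T_ℓ 𝓦_k = T_ℓ' = w T_ℓ w⁻¹`,
`𝓦_k⁻¹ [u] 𝓦_k ∝ ⟨u⟩_p⁻¹`), cgs25-r2 ADDENDUM-11 §2. [cite: KingsLoefflerZerbes2015, Lemma 7.4.2 (arXiv numbering; corpus paper:arxiv-1503.02888-gx17373040 p0064:L3–L13: the formula spec_{k+ε} 𝓦_k = Σ_α ε(α)⁻¹ ⟨α⟩_p U_p^r W_{Np^r}⁻¹; equivariance step = cgs25-r2 ADDENDUM-11 §2 «Lemma T», in-cell)] -/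
theorem sum_smul_mul_pow_mul_inv_transport {α : Type*} (s : Finset α) (c : α → K) (D : α → A)
    (U X : A) (r : ℕ) (W : Aˣ) (hD : ∀ a ∈ s, Commute X (D a)) (hU : Commute X U) :
    (∑ a ∈ s, c a • (D a * U ^ r)) * ↑W⁻¹ * ((W : A) * X * ↑W⁻¹) =
      X * ((∑ a ∈ s, c a • (D a * U ^ r)) * ↑W⁻¹) := by
  refine mul_inv_mul_conj_eq_of_commute W (Commute.sum_right _ _ _ fun a ha ↦ ?_)
  exact ((hD a ha).mul_right (hU.pow_right r)).smul_right (c a)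

end TransportSum

section TransportModule

variable {K : Type*} [CommSemiring K] {V N : Type*} [AddCommMonoid V] [Module K V]
  [AddCommMonoid N] [Module K N]

/-- **Lemma T, module form.** Let `S : V → N` intertwine `X ∈ End V` with `Y ∈ End N`
(`S ∘ X = Y ∘ S`) and let `W : V ≃ V`. Then `Op := S ∘ W⁻¹` intertwines the conjugate `W X W⁻¹`
with `Y`: `Op ∘ (W X W⁻¹) = Y ∘ Op` (the tower-side incarnation of `Y` is `W X W⁻¹`, carried
across by the equivariance of `S`, not by any `W`-invariance). [cite: KingsLoefflerZerbes2015, Lemma 7.4.2 (equivariance step; cgs25-r2 ADDENDUM-11 §2 «Lemma T», in-cell)] -/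
theorem comp_symm_comp_conj_eq (W : V ≃ₗ[K] V) (S : V →ₗ[K] N) (X : Module.End K V)
    (Y : Module.End K N) (h : S ∘ₗ X = Y ∘ₗ S) :
    (S ∘ₗ (W.symm : V →ₗ[K] V)) ∘ₗ W.conj X = Y ∘ₗ (S ∘ₗ (W.symm : V →ₗ[K] V)) := by
  ext v
  have hv := LinearMap.congr_fun h (W.symm v)
  simp only [LinearMap.coe_comp, Function.comp_apply] at hv
  simp only [LinearMap.coe_comp, Function.comp_apply, LinearEquiv.coe_coe,
    LinearEquiv.conj_apply_apply, LinearEquiv.symm_apply_apply, hv]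

/-- **Reformulation when `Op` is invertible**: if an isomorphism `Op : V ≃ N` satisfies
`Op ∘ (W X W⁻¹) = Y ∘ Op`, then `W X W⁻¹ = Op⁻¹ ∘ Y ∘ Op` («`𝓦_k⁻¹ ∘ 𝓧 ∘ 𝓦_k = W X W⁻¹`»,
cgs25-r2 ADDENDUM-11 §2, boxed statement). [cite: KingsLoefflerZerbes2015, Lemma 7.4.2 (equivariance step; cgs25-r2 ADDENDUM-11 §2 «Lemma T», in-cell)] -/
theorem conj_eq_symm_conj_of_intertwine (W : V ≃ₗ[K] V) (Op : V ≃ₗ[K] N) (X : Module.End K V)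
    (Y : Module.End K N) (h : (Op : V →ₗ[K] N) ∘ₗ W.conj X = Y ∘ₗ (Op : V →ₗ[K] N)) :
    W.conj X = Op.symm.conj Y := by
  ext v
  have hv := LinearMap.congr_fun h v
  simp only [LinearMap.coe_comp, Function.comp_apply, LinearEquiv.coe_coe] at hv
  rw [LinearEquiv.conj_apply_apply Op.symm, LinearEquiv.symm_symm, ← hv,
    LinearEquiv.symm_apply_apply]

end TransportModule

/-! ### §3 Kernels, ranges, stable subspaces, bijectivity and units under conjugation -/

section Subspaces

variable {R S : Type*} [CommSemiring R] [CommSemiring S] {σ : R →+* S} {σ' : S →+* R}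
  [RingHomInvPair σ σ'] [RingHomInvPair σ' σ]
  {M M₂ : Type*} [AddCommMonoid M] [Module R M] [AddCommMonoid M₂] [Module S M₂]
  (W : M ≃ₛₗ[σ] M₂)

/-- **Kernel transport**: `ker (W f W⁻¹) = W (ker f)`. [cite: KingsLoefflerZerbes2015, §9.5, proof of Thm 9.5.2 («Since both maps are Hecke-equivariant …»; transport bookkeeping = cgs25-r2 ADDENDUM-11 (P-i)/(P-iii), in-cell)] -/
theorem ker_conj (f : Module.End R M) :
    LinearMap.ker (W.conj f) = (LinearMap.ker f).map (W : M →ₛₗ[σ] M₂) := by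
  ext x
  rw [LinearMap.mem_ker, LinearEquiv.conj_apply_apply, Submodule.mem_map_equiv, LinearMap.mem_ker,
    LinearEquiv.map_eq_zero_iff]

/-- **Range transport**: `range (W f W⁻¹) = W (range f)`. [cite: KingsLoefflerZerbes2015, §9.5, proof of Thm 9.5.2 («Since both maps are Hecke-equivariant …»; transport bookkeeping = cgs25-r2 ADDENDUM-11 (P-i)/(P-iii), in-cell)] -/
theorem range_conj (f : Module.End R M) :
    LinearMap.range (W.conj f) = (LinearMap.range f).map (W : M →ₛₗ[σ] M₂) := by
  ext x
  rw [LinearMap.mem_range, Submodule.mem_map_equiv, LinearMap.mem_range]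
  constructor
  · rintro ⟨y, rfl⟩
    exact ⟨W.symm y, by rw [LinearEquiv.conj_apply_apply, LinearEquiv.symm_apply_apply]⟩
  · rintro ⟨y, hy⟩
    refine ⟨W y, ?_⟩
    rw [LinearEquiv.conj_apply_apply, LinearEquiv.symm_apply_apply, hy,
      LinearEquiv.apply_symm_apply]

/-- **A conjugate kills the transported subspace**: if `f` vanishes on `E` then `W f W⁻¹` vanishes
on `W(E)` (cgs25-r2 ADDENDUM-11 (P-i): `W Θ^{cl} W⁻¹` kills `W(e·Eis)`). [cite: KingsLoefflerZerbes2015, §9.5, proof of Thm 9.5.2 («Since both maps are Hecke-equivariant …»; transport bookkeeping = cgs25-r2 ADDENDUM-11 (P-i)/(P-iii), in-cell)] -/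
theorem conj_apply_eq_zero_of_forall_mem (f : Module.End R M) {E : Submodule R M}
    (hE : ∀ v ∈ E, f v = 0) {x : M₂} (hx : x ∈ E.map (W : M →ₛₗ[σ] M₂)) : W.conj f x = 0 := by
  rw [Submodule.mem_map_equiv] at hx
  rw [LinearEquiv.conj_apply_apply, hE _ hx, map_zero]

/-- **A conjugate maps into the transported target**: if `f(M) ⊆ E` then `(W f W⁻¹)(M₂) ⊆ W(E)`
((P-i): `W Θ^{cl} W⁻¹` maps into `W(S) = S`). [cite: KingsLoefflerZerbes2015, §9.5, proof of Thm 9.5.2 («Since both maps are Hecke-equivariant …»; transport bookkeeping = cgs25-r2 ADDENDUM-11 (P-i)/(P-iii), in-cell)] -/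
theorem conj_apply_mem_map_of_forall_mem (f : Module.End R M) {E : Submodule R M}
    (hE : ∀ v, f v ∈ E) (x : M₂) : W.conj f x ∈ E.map (W : M →ₛₗ[σ] M₂) := by
  rw [Submodule.mem_map_equiv, LinearEquiv.conj_apply_apply, LinearEquiv.symm_apply_apply]
  exact hE _

/-- **Stable subspaces are transported**: if `E` is `f`-stable then `W(E)` is `W f W⁻¹`-stable.
[cite: KingsLoefflerZerbes2015, §9.5, proof of Thm 9.5.2 («Since both maps are Hecke-equivariant …»; transport bookkeeping = cgs25-r2 ADDENDUM-11 (P-i)/(P-iii), in-cell)] -/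
theorem conj_apply_mem_map_of_mem_map (f : Module.End R M) {E : Submodule R M}
    (hE : ∀ v ∈ E, f v ∈ E) {x : M₂} (hx : x ∈ E.map (W : M →ₛₗ[σ] M₂)) :
    W.conj f x ∈ E.map (W : M →ₛₗ[σ] M₂) := by
  rw [Submodule.mem_map_equiv] at hx ⊢
  rw [LinearEquiv.conj_apply_apply, LinearEquiv.symm_apply_apply]
  exact hE _ hx

/-- **Bijectivity on a stable subspace is transported**: if `f` restricts to a bijection of `E`
onto itself, then `W f W⁻¹` restricts to a bijection of `W(E)` onto itself (cgs25-r2 ADDENDUM-11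
(P-iii): `W Θ^{cl} W⁻¹` is invertible on `W(S) = S` because `Θ^{cl}` is invertible on `S`).
[cite: KingsLoefflerZerbes2015, §9.5, proof of Thm 9.5.2 («Since both maps are Hecke-equivariant …»; transport bookkeeping = cgs25-r2 ADDENDUM-11 (P-i)/(P-iii), in-cell)] -/
theorem bijOn_conj_map (f : Module.End R M) {E : Submodule R M}
    (hf : Set.BijOn f E E) :
    Set.BijOn (W.conj f) (E.map (W : M →ₛₗ[σ] M₂)) (E.map (W : M →ₛₗ[σ] M₂)) := by
  refine ⟨fun x hx ↦ ?_, fun x hx y hy hxy ↦ ?_, fun y hy ↦ ?_⟩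
  · exact conj_apply_mem_map_of_mem_map W f (fun v hv ↦ hf.mapsTo hv) hx
  · rw [SetLike.mem_coe, Submodule.mem_map_equiv] at hx hy
    rw [LinearEquiv.conj_apply_apply, LinearEquiv.conj_apply_apply] at hxy
    exact W.symm.injective (hf.injOn hx hy (W.injective hxy))
  · rw [SetLike.mem_coe, Submodule.mem_map_equiv] at hy
    obtain ⟨e, he, hee⟩ := hf.surjOn hy
    refine ⟨W e, ?_, ?_⟩
    · rw [SetLike.mem_coe, Submodule.mem_map_equiv, LinearEquiv.symm_apply_apply]
      exact he
    · rw [LinearEquiv.conj_apply_apply, LinearEquiv.symm_apply_apply, hee,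
        LinearEquiv.apply_symm_apply]

/-- **Units are transported**: `W f W⁻¹` is invertible iff `f` is. [cite: KingsLoefflerZerbes2015, §9.5, proof of Thm 9.5.2 («Since both maps are Hecke-equivariant …»; transport bookkeeping = cgs25-r2 ADDENDUM-11 (P-i)/(P-iii), in-cell)] -/
theorem isUnit_conj_iff (f : Module.End R M) : IsUnit (W.conj f) ↔ IsUnit f := by
  have h : W.conj f = W.conjRingEquiv f := LinearMap.ext fun _ ↦ rfl
  rw [h]
  exact isUnit_map_iff _ _

end Subspaces

/-! ### §4 The arithmetic tail of the witness (cgs25-r2 ADDENDUM-11 §1) -/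

section Witness

/-- **Separation of the four Eisenstein eigenvalues in the witness.** In a field, if
`z ∉ {0, 1}`, `z² ≠ 1` and `ℓ ∉ {0, 1}`, then with `z̄ = z⁻¹`:
`z̄ + ℓ ≠ 1 + z̄ℓ` (as `(z̄ − 1)(1 − ℓ) ≠ 0`), `z̄ + ℓ ≠ z + ℓ` and `1 + zℓ ≠ 1 + z̄ℓ` (as `z² ≠ 1`),
`1 + zℓ ≠ z + ℓ` (as `(1 − z)(1 − ℓ) ≠ 0`). With `z = χ(ℓ)` these say that the `T_ℓ`- and
`T_ℓ'`-eigenvalues `χ̄(ℓ) + ℓ`, `1 + χ(ℓ)ℓ` of `w·E₂(𝟙, χ) ∝ E₂(χ̄, 𝟙)` avoid the set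
`{1 + χ̄(ℓ)ℓ, χ(ℓ) + ℓ}` of Eisenstein `T_ℓ`- and `T_ℓ'`-values of the `χ̄`-component, so the
quasi-projector does not kill `w·E₂(𝟙,χ)` although it kills `E₂(𝟙,χ)` (the modular-form inputs of
that witness are NOT formalised here). [cite: DiamondShurman2005, Prop. 5.2.3 (corpus book:diamond2005-first-course-modular-forms p0193:L11: eigenvalue shape ψ(p) + φ(p)p^{k-1}; separation arithmetic = cgs25-r2 ADDENDUM-11 §1 witness, in-cell)] -/
theorem eisensteinWitness_separation {F : Type*} [Field F] {z ℓ : F} (hz0 : z ≠ 0) (hz1 : z ≠ 1)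
    (hz2 : z ^ 2 ≠ 1) (hℓ0 : ℓ ≠ 0) (hℓ1 : ℓ ≠ 1) :
    z⁻¹ + ℓ ≠ 1 + z⁻¹ * ℓ ∧ z⁻¹ + ℓ ≠ z + ℓ ∧ 1 + z * ℓ ≠ 1 + z⁻¹ * ℓ ∧ 1 + z * ℓ ≠ z + ℓ := by
  have hzi1 : z⁻¹ ≠ 1 := fun h ↦ hz1 (inv_eq_one.mp h)
  have hzi : z⁻¹ ≠ z := fun h ↦ hz2 (by rw [sq, ← mul_inv_cancel₀ hz0, h])
  refine ⟨fun h ↦ ?_, fun h ↦ hzi (add_right_cancel h), fun h ↦ ?_, fun h ↦ ?_⟩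
  · have : (z⁻¹ - 1) * (1 - ℓ) = 0 := by linear_combination h
    rcases mul_eq_zero.mp this with h' | h'
    · exact hzi1 (sub_eq_zero.mp h')
    · exact hℓ1 (sub_eq_zero.mp h').symm
  · have : (z - z⁻¹) * ℓ = 0 := by linear_combination h
    rcases mul_eq_zero.mp this with h' | h'
    · exact hzi (sub_eq_zero.mp h').symm
    · exact hℓ0 h'
  · have : (1 - z) * (1 - ℓ) = 0 := by linear_combination h
    rcases mul_eq_zero.mp this with h' | h'
    · exact hz1 (sub_eq_zero.mp h').symm
    · exact hℓ1 (sub_eq_zero.mp h').symm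

end Witness

end Literature.LinearAlgebra.SemilinearConj
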